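import Literature.Computability.AlgebraicComplexity.LMR13DualSchemeDetProofs
import Mathlib.RingTheory.MvPolynomial.EulerIdentity
import Mathlib.Algebra.MvPolynomial.NoZeroDivisors
import HarnessLib

/-!
# LMR 2013 §2.1–§2.3: the equations of `𝒟ual_{k,d,N}` at a PRIME form are the divisibility
# `P ∣ det(H_P|_F)` (rung (Z0) of the first-order identity (Zar))

Cell val-lit (D-0074), row LMR13-A; lead-lmr g3 item (X2) «(Zar) in tree language»
(2026-08-26T13:09:18Z), rung (Z0); rungs (Z1)/(Z2) — the first-order identity
«`P ∣ D_π det(H_P|_F) − π·Q_F`» for tangent vectors `π` (LMR §3.3, arXiv p0006:L57–p0007:L25) and its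
converse — are owned by another seat (AC/LMR13ZariskiTangentDivisibility.lean); this file also
supplies their algebraic input `lmrRemainder_firstOrder_apex` (eq. (2) to first order in `p_d`).

Landsberg–Manivel–Ressayre 2013, §2.1 (journal p. 472): "`P ∈ Dual_{k,d,N}` if and only if, for any
`F ∈ G(k+3, W)`, … Equivalently (assuming `P` is irreducible), for any such subspace `F`, the
polynomial `P` must divide `det(H_P|_F)`"; §2.2–§2.3 turn the divisibility into the polynomial
equations (2) (`lmrRemainder`, `lmrDualEquation`) that define the scheme `𝒟ual_{k,d,N}`
(`lmrDualScheme`). The tree had only the direction "divisibility ⇒ equations"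
(`lmrDualEquation_eq_zero_of_dvd`, `LMR13DualSchemeDetProofs.lean`). This file proves the converse
for PRIME forms, so that for prime `P` of degree `d ≥ 3`
**`P ∈ 𝒟ual_{k,d,N} ↔ ∀ F, P ∣ det(H_P|_F)`** (`mem_lmrDualScheme_iff_forall_dvd_of_prime`).

## Proof ("degenerate data": evaluate eq. (2) at a ROOT of `P`)

* `lmrRemainder_of_apex_eq_zero` — if `p_d = 0` (and `d ≤ e`) the remainder polynomial (2)
  collapses to `q_e · (−1)^{e−d+1} · p_{d−1}^{e−d+1}`: only `r = e − d + 1` survives the factor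
  `p_d^{e−d+1−r}`, and then only the all-ones composition `(1,…,1)` has the right weight.
* `binCoeff_self_eq_eval`, `binCoeff_pred_eq_sum` — for a form `P` of degree `d`,
  `p_d = P(u)` and `p_{d−1} = Σ_i v_i (∂_i P)(u)` (`P(xu + yv) = x^d P(u) + x^{d−1}y ⟨∇P(u), v⟩ + …`;
  via `dehomog ∘ binRestr = aeval (u_i + v_i y)` and a first-order Taylor computation
  `coeff_zero_aeval_affineLine`, `coeff_one_aeval_affineLine`).
* `lmrDualEquation_of_eval_eq_zero` — hence at `u ∈ Z(P)`:
  `E_{B,u,v}(P) = det(B·H_P(u)·Bᵀ) · (−1)^{e−d+1} · ⟨∇P(u), v⟩^{e−d+1}`, `e = (k+3)(d−2)`.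
* `dvd_hessGenMinor_of_prime_of_mem_lmrDualScheme` — for prime `P ∈ 𝒟ual_{k,d,N}` take `v = e_i`:
  `Q(u)·(∂_iP)(u)^{e−d+1} = 0` on `Z(P)`, so `Q·∂_iP` vanishes on `Z(P)`, so `P ∣ Q·∂_iP`
  (Nullstellensatz, tree `dvd_of_prime_of_forall_eval_eq_zero`), and `P ∤ ∂_iP` for an `i` with
  `∂_iP ≠ 0` (Euler's identity in characteristic `0`; degrees), whence `P ∣ Q = det(H_P|_F)`.

Theorems only; no named facts. Honest framing: a gateway lemma of the LMR13-A ladder (Lemma 3.3.2,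
Lemma 3.4.1, Prop. 3.4.2 ⇒, Thm. 3.1.1 ⊆ all start from it); VP ≠ VNP is NOT proved and nothing here
is progress on it.

## References

* J. M. Landsberg, L. Manivel, N. Ressayre, *Hypersurfaces with degenerate duals and the geometric
  complexity theory program*, Comment. Math. Helv. 88 (2013) 469–484, §2.1 (p. 472), §2.2 eq. (1)–(2)
  (p. 473), §2.3 (pp. 473–474); arXiv:1004.4802, p0003–p0004.
-/

noncomputable section

open MvPolynomial Matrix

namespace Literature.Computability.AlgebraicComplexity

/-! ### Eq. (2) with degenerate data `p_d = 0` -/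

section Apex

variable {A : Type*} [CommRing A]

/-- **Eq. (2) at a root of `P_L(·, 0)`.** If the apex coefficient `p_d` vanishes (and `1 ≤ d ≤ e`),
the remainder polynomial (2) of LMR §2.2 collapses to
`q_e · (−1)^{e−d+1} · p_{d−1}^{e−d+1}`: in
`Σ_i q_i Σ_r (−1)^r p_d^{e−d+1−r} Σ_{j_1+⋯+j_r = i−d+1} p_{d−j_1}⋯p_{d−j_r}` only `r = e − d + 1`
survives, and `r` parts `≥ 1` of total weight `i − d + 1 ≤ e − d + 1` force `i = e` and
`j_1 = ⋯ = j_r = 1`. [cite: LandsbergManivelRessayre2013, §2.2 eq. (2) (p. 473)] -/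
theorem lmrRemainder_of_apex_eq_zero {d e : ℕ} (hd : 1 ≤ d) (hde : d ≤ e) (p q : ℕ → A)
    (hp : p d = 0) :
    lmrRemainder d e p q = q e * ((-1) ^ (e - d + 1) * p (d - 1) ^ (e - d + 1)) := by
  classical
  unfold lmrRemainder
  -- the inner sum over `r`, for a fixed `i`
  have hinner : ∀ i, i ≤ e →
      (∑ r ∈ Finset.range (e - d + 2), (-1) ^ r * p d ^ (e - d + 1 - r) *
        ∑ j ∈ (Finset.univ : Finset (Fin r → Fin d)) with (∑ l, ((j l : ℕ) + 1)) + d = i + 1,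
          ∏ l, p (d - ((j l : ℕ) + 1))) =
        if i = e then (-1) ^ (e - d + 1) * p (d - 1) ^ (e - d + 1) else 0 := by
    intro i hi
    rw [Finset.sum_eq_single_of_mem (e - d + 1) (Finset.mem_range.2 (by omega))]
    · -- the term `r = e - d + 1`
      rw [Nat.sub_self, pow_zero, mul_one]
      by_cases hie : i = e
      · rw [if_pos hie]
        congr 1
        -- only the all-ones composition has weight `e - d + 1`
        have hj0mem : (fun _ : Fin (e - d + 1) => (⟨0, hd⟩ : Fin d)) ∈
            (Finset.univ : Finset (Fin (e - d + 1) → Fin d)).filter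
              (fun j => (∑ l, ((j l : ℕ) + 1)) + d = i + 1) := by
          rw [Finset.mem_filter]
          refine ⟨Finset.mem_univ _, ?_⟩
          simp only [zero_add, Finset.sum_const, Finset.card_univ, Fintype.card_fin, smul_eq_mul,
            mul_one]
          omega
        rw [Finset.sum_eq_single_of_mem _ hj0mem]
        · simp only [zero_add, Finset.prod_const, Finset.card_univ, Fintype.card_fin]
        · intro j hj hne
          exfalso
          apply hne
          rw [Finset.mem_filter] at hj
          have hsum : ∑ l, ((j l : ℕ) + 1) = (∑ l, (j l : ℕ)) + (e - d + 1) := by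
            rw [Finset.sum_add_distrib, Finset.sum_const, Finset.card_univ, Fintype.card_fin,
              smul_eq_mul, mul_one]
          have hzero : ∑ l, (j l : ℕ) = 0 := by
            have := hj.2
            omega
          funext l
          have hl : (j l : ℕ) = 0 :=
            (Finset.sum_eq_zero_iff.1 hzero) l (Finset.mem_univ _)
          exact Fin.ext hl
      · rw [if_neg hie]
        have hempty : (Finset.univ : Finset (Fin (e - d + 1) → Fin d)).filter
            (fun j => (∑ l, ((j l : ℕ) + 1)) + d = i + 1) = ∅ := by
          refine Finset.filter_eq_empty_iff.2 fun j _ hj => ?_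
          have hsum : ∑ l, ((j l : ℕ) + 1) = (∑ l, (j l : ℕ)) + (e - d + 1) := by
            rw [Finset.sum_add_distrib, Finset.sum_const, Finset.card_univ, Fintype.card_fin,
              smul_eq_mul, mul_one]
          omega
        rw [hempty, Finset.sum_empty, mul_zero]
    · -- the terms `r < e - d + 1` carry a positive power of `p_d = 0`
      intro r hr hne
      rw [Finset.mem_range] at hr
      rw [hp, zero_pow (by omega), mul_zero, zero_mul]
  rw [Finset.sum_eq_single_of_mem e (Finset.mem_range.2 (Nat.lt_succ_self e))]
  · rw [hinner e le_rfl, if_pos rfl]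
  · intro i hi hie
    rw [Finset.mem_range] at hi
    rw [hinner i (by omega), if_neg hie, mul_zero]

end Apex

/-! ### Eq. (2) to first order in the apex coefficient `p_d` (input of the (Zar) expansion) -/

section ApexFirstOrder

variable {A : Type*} [CommRing A]

/-- The composition sums of eq. (2): no composition of `i + 1 − d` into `ρ` parts `≥ 1` exists when
`i + 1 < ρ + d`. [cite: LandsbergManivelRessayre2013, §2.2 eq. (2) (p. 473)] -/
private theorem compSum_eq_zero (p : ℕ → A) {d ρ i : ℕ} (hi : i + 1 < ρ + d) :
    (∑ j ∈ (Finset.univ : Finset (Fin ρ → Fin d)) with (∑ l, ((j l : ℕ) + 1)) + d = i + 1,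
      ∏ l, p (d - ((j l : ℕ) + 1))) = 0 := by
  classical
  have hempty : (Finset.univ : Finset (Fin ρ → Fin d)).filter
      (fun j => (∑ l, ((j l : ℕ) + 1)) + d = i + 1) = ∅ := by
    refine Finset.filter_eq_empty_iff.2 fun j _ hj => ?_
    have hsum : ∑ l, ((j l : ℕ) + 1) = (∑ l, (j l : ℕ)) + ρ := by
      rw [Finset.sum_add_distrib, Finset.sum_const, Finset.card_univ, Fintype.card_fin,
        smul_eq_mul, mul_one]
    omega
  rw [hempty, Finset.sum_empty]

/-- The composition sums of eq. (2): the unique composition of `ρ` into `ρ` parts `≥ 1` is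
`(1,…,1)`, contributing `p_{d−1}^ρ`. [cite: LandsbergManivelRessayre2013, §2.2 eq. (2) (p. 473)] -/
private theorem compSum_allOnes (p : ℕ → A) {d ρ i : ℕ} (hd : 1 ≤ d) (hi : i + 1 = ρ + d) :
    (∑ j ∈ (Finset.univ : Finset (Fin ρ → Fin d)) with (∑ l, ((j l : ℕ) + 1)) + d = i + 1,
      ∏ l, p (d - ((j l : ℕ) + 1))) = p (d - 1) ^ ρ := by
  classical
  have hj0mem : (fun _ : Fin ρ => (⟨0, hd⟩ : Fin d)) ∈
      (Finset.univ : Finset (Fin ρ → Fin d)).filter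
        (fun j => (∑ l, ((j l : ℕ) + 1)) + d = i + 1) := by
    rw [Finset.mem_filter]
    refine ⟨Finset.mem_univ _, ?_⟩
    simp only [zero_add, Finset.sum_const, Finset.card_univ, Fintype.card_fin, smul_eq_mul,
      mul_one]
    omega
  rw [Finset.sum_eq_single_of_mem _ hj0mem]
  · simp only [zero_add, Finset.prod_const, Finset.card_univ, Fintype.card_fin]
  · intro j hj hne
    exfalso
    apply hne
    rw [Finset.mem_filter] at hj
    have hsum : ∑ l, ((j l : ℕ) + 1) = (∑ l, (j l : ℕ)) + ρ := by
      rw [Finset.sum_add_distrib, Finset.sum_const, Finset.card_univ, Fintype.card_fin,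
        smul_eq_mul, mul_one]
    have hzero : ∑ l, (j l : ℕ) = 0 := by omega
    funext l
    exact Fin.ext ((Finset.sum_eq_zero_iff.1 hzero) l (Finset.mem_univ _))

/-- The composition sums of eq. (2): the compositions of `ρ + 1` into `ρ` parts `≥ 1` are the `ρ`
sequences with one part `2` and the others `1`, contributing `ρ · p_{d−2} p_{d−1}^{ρ−1}` (`d ≥ 2`).
[cite: LandsbergManivelRessayre2013, §2.2 eq. (2) (p. 473)] -/
private theorem compSum_oneTwo (p : ℕ → A) {d ρ i : ℕ} (hd : 2 ≤ d) (hi : i + 1 = ρ + d + 1) :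
    (∑ j ∈ (Finset.univ : Finset (Fin ρ → Fin d)) with (∑ l, ((j l : ℕ) + 1)) + d = i + 1,
      ∏ l, p (d - ((j l : ℕ) + 1))) = (ρ : A) * p (d - 2) * p (d - 1) ^ (ρ - 1) := by
  classical
  -- the compositions with one `2` at place `l₀`
  let g : Fin ρ → (Fin ρ → Fin d) := fun l₀ => Function.update (fun _ => ⟨0, by omega⟩) l₀ ⟨1, hd⟩
  have hg_self : ∀ l₀, ((g l₀ l₀ : Fin d) : ℕ) = 1 := fun l₀ => by simp [g]
  have hg_ne : ∀ l₀ l, l ≠ l₀ → ((g l₀ l : Fin d) : ℕ) = 0 := fun l₀ l h => by simp [g, h]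
  have hsum1 : ∀ j : Fin ρ → Fin d, ∑ l, ((j l : ℕ) + 1) = (∑ l, (j l : ℕ)) + ρ := fun j => by
    rw [Finset.sum_add_distrib, Finset.sum_const, Finset.card_univ, Fintype.card_fin, smul_eq_mul,
      mul_one]
  have hg_weight : ∀ l₀, ∑ l, ((g l₀ l : Fin d) : ℕ) = 1 := by
    intro l₀
    rw [← Finset.add_sum_erase _ _ (Finset.mem_univ l₀), hg_self,
      Finset.sum_eq_zero fun l hl => hg_ne l₀ l (Finset.ne_of_mem_erase hl), add_zero]
  have hginj : Function.Injective g := by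
    intro l₀ l₁ h
    by_contra hne
    have := congrArg (fun j => ((j l₀ : Fin d) : ℕ)) h
    simp only [hg_self, hg_ne l₁ l₀ hne] at this
    exact one_ne_zero this
  have hF : (Finset.univ : Finset (Fin ρ → Fin d)).filter
      (fun j => (∑ l, ((j l : ℕ) + 1)) + d = i + 1) = Finset.univ.image g := by
    ext j
    rw [Finset.mem_filter, Finset.mem_image]
    constructor
    · rintro ⟨-, hj⟩
      rw [hsum1] at hj
      have hone : ∑ l, (j l : ℕ) = 1 := by omega
      obtain ⟨l₀, -, hl₀⟩ := Finset.exists_ne_zero_of_sum_ne_zero (hone.trans_ne one_ne_zero)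
      refine ⟨l₀, Finset.mem_univ _, ?_⟩
      have hsplit := Finset.add_sum_erase Finset.univ (fun l => (j l : ℕ)) (Finset.mem_univ l₀)
      rw [hone] at hsplit
      have hl₀1 : (j l₀ : ℕ) = 1 := by
        have : (j l₀ : ℕ) ≤ 1 := by rw [← hsplit]; exact Nat.le_add_right _ _
        omega
      have hrest : ∑ l ∈ Finset.univ.erase l₀, (j l : ℕ) = 0 := by omega
      funext l
      by_cases hl : l = l₀
      · subst hl
        exact Fin.ext (by rw [hg_self, hl₀1])
      · exact Fin.ext (by
          rw [hg_ne l₀ l hl]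
          exact ((Finset.sum_eq_zero_iff.1 hrest) l
            (Finset.mem_erase.2 ⟨hl, Finset.mem_univ _⟩)).symm)
    · rintro ⟨l₀, -, rfl⟩
      refine ⟨Finset.mem_univ _, ?_⟩
      rw [hsum1, hg_weight]
      omega
  rw [hF, Finset.sum_image fun l₀ _ l₁ _ h => hginj h]
  have hterm : ∀ l₀, ∏ l, p (d - (((g l₀ l : Fin d) : ℕ) + 1)) = p (d - 2) * p (d - 1) ^ (ρ - 1) := by
    intro l₀
    rw [← Finset.mul_prod_erase _ _ (Finset.mem_univ l₀), hg_self,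
      Finset.prod_congr rfl fun l hl => by rw [hg_ne l₀ l (Finset.ne_of_mem_erase hl)],
      Finset.prod_const, Finset.card_erase_of_mem (Finset.mem_univ _), Finset.card_univ,
      Fintype.card_fin]
  simp only [hterm, Finset.sum_const, Finset.card_univ, Fintype.card_fin, nsmul_eq_mul]
  ring

/-- **Eq. (2) to first order in the apex coefficient `p_d`** (the input of LMR's first-order identity
(Zar), §3.3, arXiv p0006:L57–p0007:L25): for `2 ≤ d ≤ e` and over any commutative ring (so that it
can be instantiated over `ℂ[ε]` with `p_d = ε·π(u)` at a root `u` of `P`), writing `r = e − d + 1`,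
`(2) = (−1)^r q_e p_{d−1}^r + p_d · (−1)^{r−1} · ((r−1)·q_e·p_{d−2}·p_{d−1}^{r−2} + q_{e−1}·p_{d−1}^{r−1})
 + p_d² · Rest` with `Rest` the explicit sum of the terms `ρ ≤ e − d − 1` (exact identity, no
existential): the term `r` of (2) is the all-ones composition, the term `r − 1 = e − d` collects
the compositions with one part `2` (at `i = e`) and the all-ones one (at `i = e − 1`), and every term
`ρ ≤ e − d − 1` carries `p_d^{e−d+1−ρ}` with exponent `≥ 2`.
[cite: LandsbergManivelRessayre2013, §2.2 eq. (2) (p. 473)] -/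
theorem lmrRemainder_firstOrder_apex {d e : ℕ} (hd : 2 ≤ d) (hde : d ≤ e) (p q : ℕ → A) :
    lmrRemainder d e p q =
      q e * ((-1) ^ (e - d + 1) * p (d - 1) ^ (e - d + 1)) +
        p d * ((-1) ^ (e - d) * (((e - d : ℕ) : A) * q e * p (d - 2) * p (d - 1) ^ (e - d - 1) +
          q (e - 1) * p (d - 1) ^ (e - d))) +
        p d ^ 2 * ∑ i ∈ Finset.range (e + 1), q i *
          ∑ ρ ∈ Finset.range (e - d), (-1) ^ ρ * p d ^ (e - d - 1 - ρ) *
            ∑ j ∈ (Finset.univ : Finset (Fin ρ → Fin d)) with (∑ l, ((j l : ℕ) + 1)) + d = i + 1,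
              ∏ l, p (d - ((j l : ℕ) + 1)) := by
  classical
  unfold lmrRemainder
  -- split off the two top terms `ρ = e - d + 1` and `ρ = e - d` of the inner sum
  rw [show e - d + 2 = (e - d) + 1 + 1 from rfl]
  simp only [Finset.sum_range_succ (n := e - d + 1), Finset.sum_range_succ (n := e - d), mul_add]
  rw [Finset.sum_add_distrib, Finset.sum_add_distrib]
  -- the top term: the all-ones composition at `i = e`
  have htop : ∑ i ∈ Finset.range (e + 1),
      q i * ((-1) ^ (e - d + 1) * p d ^ (e - d + 1 - (e - d + 1)) *
        ∑ j ∈ (Finset.univ : Finset (Fin (e - d + 1) → Fin d)) with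
          (∑ l, ((j l : ℕ) + 1)) + d = i + 1, ∏ l, p (d - ((j l : ℕ) + 1))) =
      q e * ((-1) ^ (e - d + 1) * p (d - 1) ^ (e - d + 1)) := by
    rw [Finset.sum_eq_single_of_mem e (Finset.mem_range.2 (Nat.lt_succ_self e))]
    · rw [Nat.sub_self, pow_zero, mul_one, compSum_allOnes p (by omega) (by omega)]
    · intro i hi hie
      rw [Finset.mem_range] at hi
      rw [compSum_eq_zero p (by omega), mul_zero, mul_zero]
  -- the middle term: one part `2` at `i = e`, all ones at `i = e - 1`
  have hmid : ∑ i ∈ Finset.range (e + 1),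
      q i * ((-1) ^ (e - d) * p d ^ (e - d + 1 - (e - d)) *
        ∑ j ∈ (Finset.univ : Finset (Fin (e - d) → Fin d)) with
          (∑ l, ((j l : ℕ) + 1)) + d = i + 1, ∏ l, p (d - ((j l : ℕ) + 1))) =
      p d * ((-1) ^ (e - d) * (((e - d : ℕ) : A) * q e * p (d - 2) * p (d - 1) ^ (e - d - 1) +
        q (e - 1) * p (d - 1) ^ (e - d))) := by
    have hterm : ∀ i ∈ Finset.range (e + 1),
        q i * ((-1) ^ (e - d) * p d ^ (e - d + 1 - (e - d)) *
          ∑ j ∈ (Finset.univ : Finset (Fin (e - d) → Fin d)) with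
            (∑ l, ((j l : ℕ) + 1)) + d = i + 1, ∏ l, p (d - ((j l : ℕ) + 1))) =
        (if i = e then p d * ((-1) ^ (e - d) * (((e - d : ℕ) : A) * q e * p (d - 2) *
            p (d - 1) ^ (e - d - 1))) else 0) +
        (if i = e - 1 then p d * ((-1) ^ (e - d) * (q (e - 1) * p (d - 1) ^ (e - d))) else 0) := by
      intro i hi
      rw [Finset.mem_range] at hi
      rw [show e - d + 1 - (e - d) = 1 by omega, pow_one]
      by_cases hie : i = e
      · rw [if_pos hie, if_neg (by omega), add_zero, hie, compSum_oneTwo p hd (by omega)]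
        ring
      · rw [if_neg hie]
        by_cases hie' : i = e - 1
        · rw [if_pos hie', zero_add, hie', compSum_allOnes p (by omega) (by omega)]
          ring
        · rw [if_neg hie', add_zero, compSum_eq_zero p (by omega), mul_zero, mul_zero]
    rw [Finset.sum_congr rfl hterm, Finset.sum_add_distrib,
      Finset.sum_ite_eq' (Finset.range (e + 1)) e, if_pos (Finset.mem_range.2 (Nat.lt_succ_self e)),
      Finset.sum_ite_eq' (Finset.range (e + 1)) (e - 1), if_pos (Finset.mem_range.2 (by omega))]
    ring
  -- the low terms carry `p_d ^ 2`
  have hlow : ∑ i ∈ Finset.range (e + 1),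
      q i * ∑ ρ ∈ Finset.range (e - d), (-1) ^ ρ * p d ^ (e - d + 1 - ρ) *
        ∑ j ∈ (Finset.univ : Finset (Fin ρ → Fin d)) with (∑ l, ((j l : ℕ) + 1)) + d = i + 1,
          ∏ l, p (d - ((j l : ℕ) + 1)) =
      p d ^ 2 * ∑ i ∈ Finset.range (e + 1), q i *
        ∑ ρ ∈ Finset.range (e - d), (-1) ^ ρ * p d ^ (e - d - 1 - ρ) *
          ∑ j ∈ (Finset.univ : Finset (Fin ρ → Fin d)) with (∑ l, ((j l : ℕ) + 1)) + d = i + 1,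
            ∏ l, p (d - ((j l : ℕ) + 1)) := by
    rw [Finset.mul_sum]
    refine Finset.sum_congr rfl fun i _ => ?_
    rw [Finset.mul_sum, Finset.mul_sum, Finset.mul_sum]
    refine Finset.sum_congr rfl fun ρ hρ => ?_
    rw [Finset.mem_range] at hρ
    rw [show e - d + 1 - ρ = (e - d - 1 - ρ) + 2 by omega, pow_add]
    ring
  rw [htop, hmid, hlow]
  ring

end ApexFirstOrder

/-! ### The first two coefficients of `P(xu + yv)`: `p_d = P(u)`, `p_{d−1} = ⟨∇P(u), v⟩` -/

section Taylor

variable {A : Type*} [CommRing A] {σ : Type*}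

/-- `P(u + y v)` has constant term `P(u)` (the curve `P_ε` of LMR §3.3 restricted to a line;
Taylor to order `0`). [cite: LandsbergManivelRessayre2013, §2.2 (p. 473)] -/
theorem coeff_zero_aeval_affineLine (u v : σ → A) (P : MvPolynomial σ A) :
    (aeval (fun i => Polynomial.C (u i) + Polynomial.C (v i) * Polynomial.X) P).coeff 0 =
      eval u P := by
  classical
  induction P using MvPolynomial.induction_on with
  | C a =>
    rw [aeval_C, Polynomial.algebraMap_eq, Polynomial.coeff_C_zero, eval_C]
  | add p q hp hq => rw [map_add, Polynomial.coeff_add, hp, hq, map_add]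
  | mul_X p j hp =>
    rw [map_mul, aeval_X, Polynomial.mul_coeff_zero, hp, map_mul, eval_X, Polynomial.coeff_add,
      Polynomial.coeff_C_zero, Polynomial.coeff_C_mul, Polynomial.coeff_X_zero, mul_zero, add_zero]

/-- `P(u + y v)` has `y`-coefficient `Σ_i v_i (∂_i P)(u)` (first-order Taylor along the line
`u + ℂv` — the coefficient `p_{d−1}` of §2.2). [cite: LandsbergManivelRessayre2013, §2.2 (p. 473)] -/
theorem coeff_one_aeval_affineLine [Fintype σ] (u v : σ → A) (P : MvPolynomial σ A) :
    (aeval (fun i => Polynomial.C (u i) + Polynomial.C (v i) * Polynomial.X) P).coeff 1 =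
      ∑ i, v i * eval u (pderiv i P) := by
  classical
  induction P using MvPolynomial.induction_on with
  | C a =>
    rw [aeval_C, Polynomial.algebraMap_eq, Polynomial.coeff_C, if_neg one_ne_zero]
    symm
    exact Finset.sum_eq_zero fun i _ => by rw [pderiv_C, map_zero, mul_zero]
  | add p q hp hq =>
    rw [map_add, Polynomial.coeff_add, hp, hq, ← Finset.sum_add_distrib]
    refine Finset.sum_congr rfl fun i _ => ?_
    rw [map_add, map_add, mul_add]
  | mul_X p j hp =>
    have h0 := coeff_zero_aeval_affineLine u v p
    rw [map_mul, aeval_X, mul_add, Polynomial.coeff_add, Polynomial.coeff_mul_C, hp, ← mul_assoc,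
      Polynomial.coeff_mul_X, Polynomial.coeff_mul_C, h0]
    -- right-hand side: Leibniz
    have hrhs : ∀ i, v i * eval u (pderiv i (p * X j)) =
        v i * eval u (pderiv i p) * u j + v i * (eval u p * (Pi.single i 1 : σ → A) j) := by
      intro i
      rw [Derivation.leibniz, pderiv_X, smul_eq_mul, smul_eq_mul, map_add, map_mul, map_mul,
        eval_X, mul_add]
      have : eval u (Pi.single (M := fun _ => MvPolynomial σ A) i 1 j) =
          (Pi.single i 1 : σ → A) j := by
        by_cases hij : j = i
        · subst hij; simp
        · simp [hij]
      rw [this]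
      ring
    simp_rw [hrhs]
    rw [Finset.sum_add_distrib, ← Finset.sum_mul]
    congr 1
    rw [Finset.sum_eq_single j]
    · simp only [Pi.single_eq_same]
      ring
    · intro i _ hij
      simp [Pi.single_eq_of_ne (Ne.symm hij)]
    · intro h; exact absurd (Finset.mem_univ j) h

variable [Fintype σ]

omit [Fintype σ] in
/-- Dehomogenising the plane restriction: `P_L(1, y) = P(u + y v)`.
[cite: LandsbergManivelRessayre2013, §2.2 (p. 473)] -/
theorem dehomog_binRestr_eq_aeval (u v : σ → A) (P : MvPolynomial σ A) :
    dehomog (binRestr u v P) =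
      aeval (fun i => Polynomial.C (u i) + Polynomial.C (v i) * Polynomial.X) P := by
  have hfun : (fun i => aeval ![(1 : Polynomial A), Polynomial.X]
      (C (u i) * X 0 + C (v i) * X 1 : MvPolynomial (Fin 2) A)) =
      fun i => Polynomial.C (u i) + Polynomial.C (v i) * Polynomial.X := by
    funext i
    simp only [map_add, map_mul, aeval_C, aeval_X, Matrix.cons_val_zero, Matrix.cons_val_one,
      mul_one, Polynomial.algebraMap_eq]
  rw [binRestr, dehomog, ← AlgHom.comp_apply, MvPolynomial.comp_aeval, hfun]

omit [Fintype σ] in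
/-- **`p_d = P(u)`**: the coefficient of `x^d` in `P_L(x,y) = P(xu + yv)` is the value of the form at
`u` (the point of the line `D = ℂu`). [cite: LandsbergManivelRessayre2013, §2.2 (p. 473)] -/
theorem binCoeff_self_eq_eval {P : MvPolynomial σ A} {d : ℕ} (hP : P.IsHomogeneous d)
    (u v : σ → A) : binCoeff d u v P d = eval u P := by
  have h := coeff_dehomog (binRestr_isHomogeneous hP u v) 0
  rw [if_pos (Nat.zero_le d), Nat.sub_zero, dehomog_binRestr_eq_aeval,
    coeff_zero_aeval_affineLine] at h
  rw [binCoeff, Nat.sub_self]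
  exact h.symm

/-- **`p_{d−1} = ⟨∇P(u), v⟩`**: the coefficient of `x^{d−1} y` in `P(xu + yv)` is the derivative of
`P` at `u` in the direction `v` (`d ≥ 1`). [cite: LandsbergManivelRessayre2013, §2.2 (p. 473)] -/
theorem binCoeff_pred_eq_sum {P : MvPolynomial σ A} {d : ℕ} (hP : P.IsHomogeneous d) (hd : 1 ≤ d)
    (u v : σ → A) : binCoeff d u v P (d - 1) = ∑ i, v i * eval u (pderiv i P) := by
  have h := coeff_dehomog (binRestr_isHomogeneous hP u v) 1
  rw [if_pos hd, dehomog_binRestr_eq_aeval, coeff_one_aeval_affineLine] at h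
  rw [binCoeff, show d - (d - 1) = 1 by omega]
  exact h.symm

end Taylor

/-! ### Eq. (2) of §2.3 at a root of `P`; prime forms -/

section Prime

variable {σ : Type*} [Fintype σ]

/-- **The equation `E_{B,u,v}(P)` at a point `u ∈ Z(P)`** ("degenerate data"): for a form `P` of
degree `d ≥ 3` with `P(u) = 0`,
`E_{B,u,v}(P) = det(B · H_P(u) · Bᵀ) · (−1)^{e−d+1} · ⟨∇P(u), v⟩^{e−d+1}`, `e = (k+3)(d−2)`.
[cite: LandsbergManivelRessayre2013, §2.2–§2.3 (p. 473)] -/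
theorem lmrDualEquation_of_eval_eq_zero {A : Type*} [CommRing A] {κ d : ℕ} (hd : 3 ≤ d)
    {P : MvPolynomial σ A} (hP : P.IsHomogeneous d) (B : Matrix (Fin (κ + 3)) σ A) (u v : σ → A)
    (hu : eval u P = 0) :
    lmrDualEquation κ d B u v P =
      eval u (hessGenMinor B B P) *
        ((-1) ^ ((κ + 3) * (d - 2) - d + 1) *
          (∑ i, v i * eval u (pderiv i P)) ^ ((κ + 3) * (d - 2) - d + 1)) := by
  have hde : d ≤ (κ + 3) * (d - 2) := by
    have : 3 * (d - 2) ≤ (κ + 3) * (d - 2) := Nat.mul_le_mul_right _ (by omega)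
    omega
  unfold lmrDualEquation
  rw [lmrRemainder_of_apex_eq_zero (by omega) hde _ _
      (by rw [binCoeff_self_eq_eval hP, hu]),
    binCoeff_self_eq_eval (isHomogeneous_hessGenMinor B B hP), binCoeff_pred_eq_sum hP (by omega)]

/-- A nonzero form of positive degree over `ℂ` has a nonzero partial derivative (Euler's identity
`Σ x_i ∂_i P = d · P`). [folklore] -/
private theorem exists_pderiv_ne_zero {P : MvPolynomial σ ℂ} {d : ℕ} (hP : P.IsHomogeneous d)
    (hd : d ≠ 0) (hP0 : P ≠ 0) : ∃ i, pderiv i P ≠ 0 := by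
  by_contra h
  simp only [not_exists, not_not] at h
  have heuler := hP.sum_X_mul_pderiv
  rw [Finset.sum_eq_zero fun i _ => by rw [h i, mul_zero], nsmul_eq_mul] at heuler
  rcases mul_eq_zero.1 heuler.symm with h1 | h1
  · exact hd (Nat.cast_eq_zero.1 h1)
  · exact hP0 h1

omit [Fintype σ] in
/-- A form does not divide its own nonzero partial derivatives (degrees). [folklore] -/
private theorem not_dvd_pderiv {P : MvPolynomial σ ℂ} {d : ℕ} (hP : P.IsHomogeneous d) (hP0 : P ≠ 0)
    {i : σ} (hi : pderiv i P ≠ 0) : ¬ P ∣ pderiv i P := by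
  rintro ⟨c, hc⟩
  have hc0 : c ≠ 0 := fun h => hi (by rw [hc, h, mul_zero])
  have hdeg := congrArg totalDegree hc
  rw [totalDegree_mul_of_isDomain hP0 hc0, hP.totalDegree hP0,
    (hP.pderiv (i := i)).totalDegree hi] at hdeg
  have hd : d ≠ 0 := by
    rintro rfl
    have hPc : P = C (coeff 0 P) :=
      (totalDegree_eq_zero_iff_eq_C).1 (Nat.le_zero.1 hP.totalDegree_le)
    exact hi (by rw [hPc, pderiv_C])
  omega

/-- **(Z0) For a PRIME form, the equations of `𝒟ual_{k,d,N}` give back the divisibility**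
(LMR 2013 §2.1, p. 472: "Equivalently (assuming `P` is irreducible), for any such subspace `F`, the
polynomial `P` must divide `det(H_P|_F)`"): if `P` is prime of degree `d ≥ 3` and all `E_{B,u,v}(P)`
vanish, then `P ∣ det(B·H_P·Bᵀ)` for every `(k+3)`-frame `B`. Proof: at `u ∈ Z(P)` with `v = e_i`
the equation reads `Q(u)·(∂_iP)(u)^{e−d+1} = 0` (`lmrDualEquation_of_eval_eq_zero`), so `Q·∂_iP`
vanishes on `Z(P)` and `P ∣ Q·∂_iP` (Nullstellensatz, `dvd_of_prime_of_forall_eval_eq_zero`); choose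
`i` with `∂_iP ≠ 0`, then `P ∤ ∂_iP`. [cite: LandsbergManivelRessayre2013, §2.1 (p. 472)] -/
theorem dvd_hessGenMinor_of_prime_of_mem_lmrDualScheme {κ d : ℕ} (hd : 3 ≤ d)
    {P : MvPolynomial σ ℂ} (hprime : Prime P) (hmem : P ∈ lmrDualScheme κ d)
    (B : Matrix (Fin (κ + 3)) σ ℂ) : P ∣ hessGenMinor B B P := by
  classical
  have hP : P.IsHomogeneous d := hmem.1
  obtain ⟨i, hi⟩ := exists_pderiv_ne_zero hP (by omega) hprime.ne_zero
  have hvan : ∀ x : σ → ℂ, eval x P = 0 → eval x (hessGenMinor B B P * pderiv i P) = 0 := by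
    intro x hx
    have h := hmem.2 B x (Pi.single i 1)
    rw [lmrDualEquation_of_eval_eq_zero hd hP B x _ hx] at h
    have hsum : ∑ j, (Pi.single i 1 : σ → ℂ) j * eval x (pderiv j P) = eval x (pderiv i P) := by
      rw [Finset.sum_eq_single i]
      · simp
      · intro j _ hji; simp [hji]
      · intro h; exact absurd (Finset.mem_univ i) h
    rw [hsum] at h
    rw [map_mul]
    rcases mul_eq_zero.1 h with h1 | h1
    · rw [h1, zero_mul]
    · rcases mul_eq_zero.1 h1 with h2 | h2
      · exact absurd h2 (pow_ne_zero _ (neg_ne_zero.2 one_ne_zero))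
      · rw [pow_eq_zero_iff'.1 h2 |>.1, mul_zero]
  have hdvd : P ∣ hessGenMinor B B P * pderiv i P :=
    dvd_of_prime_of_forall_eval_eq_zero hprime hvan
  rcases hprime.dvd_or_dvd hdvd with h | h
  · exact h
  · exact absurd h (not_dvd_pderiv hP hprime.ne_zero hi)

/-- **`𝒟ual_{k,d,N}` at prime forms = divisibility** (LMR 2013 §2.1–§2.3): for a prime form `P` of
degree `d ≥ 3`, `P ∈ lmrDualScheme k d ↔ ∀ B, P ∣ hessGenMinor B B P` — `⇐` is the tree's
`lmrDualEquation_eq_zero_of_dvd`, `⇒` is (Z0). [cite: LandsbergManivelRessayre2013, §2.1–§2.3 (pp. 472–474)] -/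
theorem mem_lmrDualScheme_iff_forall_dvd_of_prime {κ d : ℕ} (hd : 3 ≤ d) {P : MvPolynomial σ ℂ}
    (hP : P.IsHomogeneous d) (hprime : Prime P) :
    P ∈ lmrDualScheme κ d ↔ ∀ B : Matrix (Fin (κ + 3)) σ ℂ, P ∣ hessGenMinor B B P :=
  ⟨fun hmem B => dvd_hessGenMinor_of_prime_of_mem_lmrDualScheme hd hprime hmem B,
    fun h => ⟨hP, fun B u v => lmrDualEquation_eq_zero_of_dvd hd hP B u v (h B)⟩⟩

/-- Pointwise form of (Z0) (LMR §2.1: "`det(H_P|_F)|_{Z(P)} = 0`"): for prime `P ∈ 𝒟ual_{k,d,N}` the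
generalised Hessian minors vanish on the hypersurface `Z(P)`.
[cite: LandsbergManivelRessayre2013, §2.1 (p. 472)] -/
theorem eval_hessGenMinor_eq_zero_of_prime_of_mem_lmrDualScheme {κ d : ℕ} (hd : 3 ≤ d)
    {P : MvPolynomial σ ℂ} (hprime : Prime P) (hmem : P ∈ lmrDualScheme κ d)
    (B : Matrix (Fin (κ + 3)) σ ℂ) {x : σ → ℂ} (hx : eval x P = 0) :
    (B * hessianMatrix P x * Bᵀ).det = 0 := by
  classical
  obtain ⟨c, hc⟩ := dvd_hessGenMinor_of_prime_of_mem_lmrDualScheme hd hprime hmem B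
  rw [← eval_hessGenMinor, hc, map_mul, hx, zero_mul]

end Prime

end Literature.Computability.AlgebraicComplexity

end
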